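import Summits.ResolutionOfSingularities.ResolutionOfSingularities.Theorems.WeightedInvariantELadderOneCentre
import Summits.ResolutionOfSingularities.ResolutionOfSingularities.Theorems.WeightedInvariantOrbitCentreHomogeneousUnconditional
import Summits.ResolutionOfSingularities.ResolutionOfSingularities.Theorems.AQSHeightTwoCentreHolds
import HarnessLib

/-!
# Rung `e = 1` of the door: the centre of a singular stage, UNCONDITIONALLY

Route `ResolutionOfSingularities/WeightedInvariant`, door crux `HypersurfaceCentreConstruction`
(stmt-ResolutionOfSingularities-19897) — OURS; e-ladder `e = 1` (res-D-pv-025 AS stub-10).  The registered stub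
`ELadderOne.stub_e1_centre` (p519176) takes the two vendored Abramovich–Quek–Schober facts as hypotheses.  Both are now
THEOREMS where the rung uses them: `hAQS₁` = `AQSHeightTwo.AbramovichQuekSchober2025_heightTwoCentre_holds` (the (o25)
team of res-type-092, 2026-08-27), and `hAQS₂` only at `k(ℤʲ)`, discharged by `AQSBaseChange.separableBaseChange_of_essFiniteType`
through `OrbitCentreHomogeneous.isHomogeneous_germContractionIdeal_weightedMonomialIdeal_unconditional` ((U1)).  Hence:

* `OrbitCentreHomogeneous.isHomogeneous_ofGermFiltration_piece_ideal_unconditional` — res-type-047's (L3-w) closer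
  (p517498) without `hAQS₂`;
* `ELadderOne.Stage.exists_orbitCentre` — the orbit centre with its drop rider (= `exists_orbitCentre_of_aqs`, p519176)
  without `hAQS₂`;
* `ELadderOne.stub_e1_centre_of_heightTwoCentre` — the stub's conclusion from `hAQS₁` alone;
* **`ELadderOne.exists_isAdmissibleCentre`** — the stub's conclusion with NO hypothesis beyond the stage data.

Nothing here is a claim about Hironaka's problem or about any manuscript under adjudication; AI-written, weaker than
expert review.  [cite: AbramovichQuekSchober2025, Thm 1.3 (1)(3), Thm 3.5]
-/

noncomputable section

set_option linter.dupNamespace false -- mandated namespace of this single-conjunct summit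

open CategoryTheory AlgebraicGeometry TopologicalSpace IsLocalRing Opposite
open Literature.AlgebraicGeometry.Resolution
open Summit.ResolutionOfSingularities.ResolutionOfSingularities.Theorems

namespace Summit.ResolutionOfSingularities.ResolutionOfSingularities.Theorems

/-! ## (L3-w) without `hAQS₂` -/

/-- **(L3) in the binder shape of `IsAdmissibleCentre`'s clause (hom), unconditionally** (res-type-047's p517498
`isHomogeneous_ofGermFiltration_weightedMonomialIdeal_piece_ideal` with the separable-base-change clause discharged).
[cite: AbramovichQuekSchober2025, Thm 1.1 (1) via Thm 3.5 / §5 (i)] -/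
theorem OrbitCentreHomogeneous.isHomogeneous_ofGermFiltration_piece_ideal_unconditional
    {k : Type} [Field k] {Y : Scheme.{0}} (f : Y ⟶ Spec (.of k)) [LocallyOfFiniteType f]
    (X : Y.IdealSheafData) (η : Y) (hη : η ∈ singImage X)
    (hmax : ∀ y ∈ singImage X, η ∈ closure ({y} : Set Y) → y = η)
    (hreg : IsRegularLocalRing (Y.presheaf.stalk η))
    (hdim : ringKrullDim (Y.presheaf.stalk η) = ((2 : ℕ) : WithBot ℕ∞))
    (hprinc : (stalkIdeal X η).IsPrincipal)
    (x : Fin 2 → Y.presheaf.stalk η) (w : Fin 2 → ℕ) (ℓ : ℕ)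
    (hx : IsLexMaxWeightedCentreGerm (Y.presheaf.stalk η) (stalkIdeal X η) x w ℓ)
    (h0 : weightedMonomialIdeal x w 0 = ⊤)
    (hmul : ∀ m n, weightedMonomialIdeal x w m * weightedMonomialIdeal x w n ≤ weightedMonomialIdeal x w (m + n))
    (hprim : ∀ n, ∃ N : ℕ, maximalIdeal (Y.presheaf.stalk η) ^ N ≤ weightedMonomialIdeal x w n)
    (j : ℕ) (W : Y.affineOpens) (𝒜 : (Fin j → ℤ) → AddSubgroup Γ(Y, W)) [GradedRing 𝒜]
    (hX : (X.ideal W).IsHomogeneous 𝒜) (n : ℕ) :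
    (((ReesAlgebraData.ofGermFiltration η (fun n => weightedMonomialIdeal x w n) h0 hmul hprim).piece n).ideal
      W).IsHomogeneous 𝒜 := by
  change (germContractionIdeal η (weightedMonomialIdeal x w n) W).IsHomogeneous 𝒜
  by_cases hηW : η ∈ (W : Y.Opens)
  · exact OrbitCentreHomogeneous.isHomogeneous_germContractionIdeal_weightedMonomialIdeal_unconditional f X η hreg hdim
      hprinc x w ℓ hx W hηW 𝒜 hX (OrbitCentreHomogeneous.isHomogeneous_primeIdealOf_of_maximal_singImage f X hη hmax W hηW 𝒜 hX) n
  · rw [germContractionIdeal_of_not_mem η _ hηW]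
    exact Ideal.IsHomogeneous.top 𝒜

namespace ELadderOne

namespace Stage

variable {k : Type} [Field k] (S : Stage k)

/-- **The orbit centre at a maximal singular point, without `hAQS₂`** (= `exists_orbitCentre_of_aqs` of p519176 with
(L3) taken from the unconditional closers). [cite: AbramovichQuekSchober2025, Thm 1.3 (1)(3), Thm 3.5] -/
theorem exists_orbitCentre (hAQS₁ : AbramovichQuekSchober2025_heightTwoCentre) (hInv : S.Inv') {η : S.Y}
    (hη : η ∈ S.maxSing) (hreg : IsRegularLocalRing (S.Y.presheaf.stalk η))
    (hdim : ringKrullDim (S.Y.presheaf.stalk η) = ((2 : ℕ) : WithBot ℕ∞))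
    (hprinc : (stalkIdeal S.i.ker η).IsPrincipal) (hne : stalkIdeal S.i.ker η ≠ ⊥)
    (hnot : ∀ y ∈ maximalIdeal (S.Y.presheaf.stalk η), y ∉ maximalIdeal (S.Y.presheaf.stalk η) ^ 2 →
      ∀ ν : ℕ, stalkIdeal S.i.ker η ≠ Ideal.span {y ^ ν}) :
    ∃ R : ReesAlgebraData S.Y, IsAdmissibleCentre S.f S.i.ker R ∧ R.support = closure ({η} : Set S.Y) ∧
      ∀ (P : ReesAlgebraData S.Y) (R' : ReesFiltration S.Y), R'.ideal = P.piece → P.IsRegularWeightedCentre →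
        (∀ W : S.Y.affineOpens,
          (∀ η' ∈ S.maxSing, η' ≠ η → Disjoint ((W : S.Y.Opens) : Set S.Y) (closure ({η'} : Set S.Y))) →
          ∀ n, (P.piece n).ideal W = (R.piece n).ideal W) →
        ∀ b : ↥R'.plus, R'.πPlus b = η →
          idealOrder (R'.strictTransformPlus S.i.ker) b < idealOrder S.i.ker η := by
  classical
  haveI : IsLocallyNoetherian S.Y := LocallyOfFiniteType.isLocallyNoetherian S.f
  have hY : Scheme.IsRegular S.Y := Scheme.IsRegular.of_smooth S.f (Scheme.isRegular_Spec (.of k))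
  -- A2: the chart at `η`, read on `Y`
  obtain ⟨V, hηV, RV, U, hηU, u, w, ℓ, hchart, hlex, hsuppV, hdropV⟩ :=
    exists_lexMax_chart_of_aqs hAQS₁ S.f S.i.ker η hreg hdim hprinc hne hnot
  set U' : S.Y.Opens := V.ι ''ᵁ (U : (V : Scheme.{0}).Opens) with hU'
  have hηU' : η ∈ U' := ⟨⟨η, hηV⟩, hηU, rfl⟩
  set x : Fin 2 → S.Y.presheaf.stalk η := fun i => (S.Y.presheaf.germ U' η hηU').hom (u i) with hxdef
  have hspan := hlex.1
  have hwpos := hlex.2.1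
  have hw10 := hlex.2.2.2.1
  have hxm : ∀ i, x i ∈ maximalIdeal (S.Y.presheaf.stalk η) := fun i =>
    hspan ▸ Ideal.subset_span (Set.mem_range_self i)
  have h0 : weightedMonomialIdeal x w 0 = ⊤ := weightedMonomialIdeal_zero x w
  have hmul : ∀ a b, weightedMonomialIdeal x w a * weightedMonomialIdeal x w b ≤
      weightedMonomialIdeal x w (a + b) := weightedMonomialIdeal_mul_le x w
  have hprim : ∀ n, ∃ N : ℕ, maximalIdeal (S.Y.presheaf.stalk η) ^ N ≤ weightedMonomialIdeal x w n :=
    fun n => ⟨n, maximalIdeal_pow_le_weightedMonomialIdeal x w hwpos hspan n⟩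
  -- the orbit centre
  let R : ReesAlgebraData S.Y :=
    ReesAlgebraData.ofGermFiltration η (fun n => weightedMonomialIdeal x w n) h0 hmul hprim
  -- A4: regular weighted centre
  have hregc : R.IsRegularWeightedCentre := by
    refine S.isRegularWeightedCentre_ofGermFiltration hInv hη x w (hwpos 1) hw10 hspan h0 hmul hprim ?_ ?_
    · intro a ha hηa
      letI := S.atlas.gradedRing a
      exact OrbitCentreHomogeneous.isHomogeneous_germContractionIdeal_weightedMonomialIdeal_unconditional S.f S.i.ker
        η hreg hdim hprinc x w ℓ hlex (S.atlas.W a) hηa (S.atlas.piece a) (S.atlas.isHomogeneous_ker a)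
        (hInv.invOrbit a ha η hη hηa).1 (w 0)
    · intro a ha hηa g d hgd hgP hgη hli y hya hyc hgy
      letI := S.atlas.gradedRing a
      exact linearIndependent_toCotangent_of_mem_closure_orbit S.f hY (S.atlas.W a) (S.atlas.piece a) hηa
        (hInv.invOrbit a ha η hη hηa).1 (hInv.invOrbit a ha η hη hηa).2 hdim g d hgd hgP hgη hli y hya hyc hgy
  -- support
  have hsupp : R.support = closure ({η} : Set S.Y) :=
    support_ofGermFiltration η _ h0 hmul hprim fun n hn =>
      weightedMonomialIdeal_ne_top_of_le x w (maximalIdeal.isMaximal _).ne_top hxm hn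
  -- A3: (hom) for all chart gradings
  have hadm : IsAdmissibleCentre S.f S.i.ker R := by
    refine ⟨hregc, hsupp ▸ S.closure_subset_singImage hη.1, ?_⟩
    intro j W 𝒜 _ _h𝒜 hX n
    exact OrbitCentreHomogeneous.isHomogeneous_ofGermFiltration_piece_ideal_unconditional S.f S.i.ker
      η hη.1 hη.2 hreg hdim hprinc x w ℓ hlex h0 hmul hprim j W 𝒜 hX n
  refine ⟨R, hadm, hsupp, ?_⟩
  -- A5: the drop rider over `η`
  intro P R' hR' hP hloc b hb
  -- an open neighbourhood of `η` missing the other orbit closures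
  let C : Set S.Y := ⋃ η' ∈ S.maxSing \ {η}, closure ({η'} : Set S.Y)
  have hC : IsClosed C :=
    (S.maxSing_finite.subset Set.sdiff_subset).isClosed_biUnion fun _ _ => isClosed_closure
  have hηC : η ∉ C := by
    intro h
    obtain ⟨η', hη', hηη'⟩ := Set.mem_iUnion₂.mp h
    exact S.not_mem_closure_of_mem_maxSing hη hη'.1 (fun heq => hη'.2 (heq ▸ rfl : η' ∈ ({η} : Set S.Y))) hηη'
  -- a basic open `D(h) ∋ η` of the chart `U` inside it
  obtain ⟨h, hhle, hηh⟩ := exists_basicOpen_le_of_mem U (V.ι ⁻¹ᵁ ⟨Cᶜ, hC.isOpen_compl⟩) hηU hηC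
  let D : (V : Scheme.{0}).affineOpens := (V : Scheme.{0}).affineBasicOpen h
  have hDU : (D : (V : Scheme.{0}).Opens) ≤ U := (V : Scheme.{0}).basicOpen_le h
  let W : S.Y.affineOpens := ⟨V.ι ''ᵁ (D : (V : Scheme.{0}).Opens), D.2.image_of_isOpenImmersion V.ι⟩
  have hηW : η ∈ (W : S.Y.Opens) := ⟨⟨η, hηV⟩, hηh, rfl⟩
  have hWdisj : ∀ η' ∈ S.maxSing, η' ≠ η →
      Disjoint ((W : S.Y.Opens) : Set S.Y) (closure ({η'} : Set S.Y)) := by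
    intro η' hη' hne'
    rw [Set.disjoint_left]
    rintro _ ⟨z, hz, rfl⟩ hzc
    have hzC : (V.ι.base z : S.Y) ∉ C := hhle hz
    exact hzC (Set.mem_iUnion₂.mpr ⟨η', ⟨hη', hne'⟩, hzc⟩)
  -- the restricted chart on `D(h)` and its reading on `Y`
  have hchartD := isWeightedChart_restrict hchart D hDU
  have hRP : ∀ n, (RV.piece n).ideal D =
      ((P.piece n).ideal W).comap (V.ι.appIso (D : (V : Scheme.{0}).Opens)).inv.hom := by
    intro n
    have hcomap : ∀ J : Ideal Γ(S.Y, W),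
        J.comap (V.ι.appIso (D : (V : Scheme.{0}).Opens)).inv.hom = J := by
      intro J
      rw [Scheme.Opens.ι_appIso]
      exact Ideal.ext fun _ => Iff.rfl
    rw [hcomap, hloc W hWdisj n]
    change (RV.piece n).ideal D = germContractionIdeal η (weightedMonomialIdeal x w n) W
    rw [← germContractionIdeal_image_eq_piece_ideal (fun y => hY y) hchartD hηh hsuppV n]
    congr 2
    funext i
    exact TopCat.Presheaf.germ_res_apply S.Y.presheaf (V.ι.opensFunctor.map (homOfLE hDU)) η hηW (u i)
  exact DropTransport.idealOrder_strictTransformPlus_lt_of_local_basicOpen P R' hR' S.i.ker η V hηV RV U hdropV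
    h hηh hP hRP b hb

end Stage

variable {k : Type} [Field k]

/-- **`stub_e1_centre` from `hAQS₁` alone.** [cite: AbramovichQuekSchober2025, Thm 1.3 (1)(3), Thm 3.5] -/
theorem stub_e1_centre_of_heightTwoCentre (hAQS₁ : AbramovichQuekSchober2025_heightTwoCentre)
    (S : Stage k) (hInv : S.Inv') (hsing : ¬ Scheme.IsRegular S.X) :
    ∃ R : ReesAlgebraData S.Y, IsAdmissibleCentre S.f S.i.ker R ∧ R.support = singImage S.i.ker ∧
      ∀ (R' : ReesFiltration S.Y), R'.ideal = R.piece →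
        ∀ b : ↥R'.plus, R'.πPlus b ∈ S.maxSing →
          idealOrder (R'.strictTransformPlus S.i.ker) b < idealOrder S.i.ker (R'.πPlus b) := by
  obtain ⟨_, _⟩ := S.maxSing_nonempty_iff.mpr hsing -- (the registered hypothesis; not needed below)
  obtain ⟨R, P, hR, -, hadm, hsupp, hloc⟩ :=
    S.exists_isAdmissibleCentre_support_eq_singImage_of_unitCharts_of_forall_exists hInv.invOrbit _
      (fun η hη => by
        obtain ⟨hreg, hdim, hprinc, hne, hnot⟩ := S.aqs_hypotheses_of_mem_maxSing hInv hη
        exact S.exists_orbitCentre hAQS₁ hInv hη hreg hdim hprinc hne hnot)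
  refine ⟨P, hadm, hsupp, fun R' hR' b hb => ?_⟩
  exact (hR _ hb).2.2 P R' hR' hadm.1 (hloc _ hb) b rfl

/-- **THE CENTRE OF A SINGULAR STAGE, UNCONDITIONALLY**: under `Inv'`, a singular stage carries an admissible centre
supported on the whole of `singImage` whose cobordant blow-up lowers the order of the hypersurface at every point over
every maximal point of `singImage` — the conclusion of the registered stub `stub_e1_centre` with BOTH vendored
Abramovich–Quek–Schober facts discharged (`AQSHeightTwo.AbramovichQuekSchober2025_heightTwoCentre_holds`, and the
separable base change at `k(ℤʲ)`). [cite: AbramovichQuekSchober2025, Thm 1.3 (1)(3), Thm 3.5] -/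
theorem exists_isAdmissibleCentre (S : Stage k) (hInv : S.Inv') (hsing : ¬ Scheme.IsRegular S.X) :
    ∃ R : ReesAlgebraData S.Y, IsAdmissibleCentre S.f S.i.ker R ∧ R.support = singImage S.i.ker ∧
      ∀ (R' : ReesFiltration S.Y), R'.ideal = R.piece →
        ∀ b : ↥R'.plus, R'.πPlus b ∈ S.maxSing →
          idealOrder (R'.strictTransformPlus S.i.ker) b < idealOrder S.i.ker (R'.πPlus b) :=
  stub_e1_centre_of_heightTwoCentre AQSHeightTwo.AbramovichQuekSchober2025_heightTwoCentre_holds S hInv hsing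

end ELadderOne

end Summit.ResolutionOfSingularities.ResolutionOfSingularities.Theorems

end
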